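import Mathlib
import Summits.RiemannHypothesis.RiemannHypothesis.Theorems.SignConeConeMagnificationStubTransfer

/-!
# Crux `SignCone.ConeMagnification` (stmt-RiemannHypothesis-16303), line `Sketch` r8, stub `stub_designOfTypes`:
# limit bookkeeping for the type inequalities (design algebra §2, analytic glue)

Seat-0 programme for the open core `stub_designOfTypes`.  The type-inequality hypothesis TI of the skeleton hands
over, for every finitely supported complex design `α`, a LIMIT `T(α)` of the partial sums
`Σ_{n ≤ x} (d(n)/n) Re Φ_α(n)` (`d = c − Λ`) with `T(α) ≤ ½ Re Φ_α(1)`; the local hypothesis Loc says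
`Σ_{p ∣ n} c(n)/n < ∞` for every prime `p`.  This file turns these into the working tools of the programme:

* `sum_Icc_eq_sum_range`, `tendsto_sum_Icc_floor_of_summable` — partial sums over `[1, ⌊x⌋]` of a summable
  sequence tend to its `tsum`;
* `exists_C1` — TI at `α = δ₁`: the partial sums of `d(n)/n` converge to some `C₁ ≤ 1/2`;
* `tendsto_TI_profile` — TI for a design whose gcd form is `K · Z(n)` (`K > 0`): the partial sums of
  `(d(n)/n) Re Z(n)` converge to some `T ≤ ½ Re Z(1)`;
* `summable_dvd_vonMangoldt_div`, `summable_dvd_abs_dwt_div`, `summable_touch_abs_dwt_div` — Loc makes `d(n)/n`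
  absolutely summable on the multiples of any prime, hence on the set of `n` touching a finite set `Q` of primes;
* `TI_touch_decomposition` — if a real profile `ψ` is constant `= ψ₀` off the `Q`-touching integers and bounded, the
  TI limit of `(d/n)ψ` equals `ψ₀ C₁ + Σ'_{n touching Q} (d(n)/n)(ψ(n) − ψ₀)`.
-/

noncomputable section

-- `Summit.RiemannHypothesis.RiemannHypothesis.…` repeats a namespace component by design (D-0017 layout).
set_option linter.dupNamespace false

open Finset Filter
open scoped BigOperators ComplexConjugate Topology

namespace Summit.RiemannHypothesis.RiemannHypothesis.Theorems.SignConeConeMagnification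

namespace Design

open Summit.RiemannHypothesis.RiemannHypothesis.Cruxes.ConeMagnification.Sketch
  (summable_vonMangoldt_nonprime_rpow)

/-! ### Partial sums over `[1, ⌊x⌋]` -/

/-- `Σ_{n ∈ [1,N]} g(n) = Σ_{n < N+1} g(n)` when `g(0) = 0`. [folklore] -/
theorem sum_Icc_eq_sum_range (g : ℕ → ℝ) (hg : g 0 = 0) (N : ℕ) :
    ∑ n ∈ Finset.Icc 1 N, g n = ∑ n ∈ Finset.range (N + 1), g n := by
  induction N with
  | zero => simp [hg]
  | succ N ih => rw [Finset.sum_Icc_succ_top (by omega), ih, Finset.sum_range_succ _ (N + 1)]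

/-- Partial sums over `[1, ⌊x⌋]` of a summable real sequence with `g(0) = 0` tend to `Σ' g`. [folklore] -/
theorem tendsto_sum_Icc_floor_of_summable (g : ℕ → ℝ) (hg : g 0 = 0) (hs : Summable g) :
    Tendsto (fun x : ℝ => ∑ n ∈ Finset.Icc 1 ⌊x⌋₊, g n) atTop (𝓝 (∑' n, g n)) := by
  have h1 : Tendsto (fun N : ℕ => ∑ n ∈ Finset.range N, g n) atTop (𝓝 (∑' n, g n)) :=
    hs.hasSum.tendsto_sum_nat
  have h2 : Tendsto (fun N : ℕ => ∑ n ∈ Finset.Icc 1 N, g n) atTop (𝓝 (∑' n, g n)) := by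
    have := h1.comp (tendsto_add_atTop_nat 1)
    refine this.congr fun N => ?_
    simp only [Function.comp_apply]
    rw [sum_Icc_eq_sum_range g hg]
  exact h2.comp tendsto_nat_floor_atTop

/-- Partial sums over `[1, ⌊x⌋]` have at most one limit. [folklore] -/
theorem tendsto_floor_unique {g : ℝ → ℝ} {a b : ℝ} (ha : Tendsto g atTop (𝓝 a)) (hb : Tendsto g atTop (𝓝 b)) :
    a = b :=
  tendsto_nhds_unique ha hb

/-! ### The constant `C₁` (TI at the trivial design) -/

/-- **`C₁` exists and is `≤ 1/2`**: the type inequality at `α = δ₁` says that `Σ_{n≤x} (c(n) − Λ(n))/n`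
converges to some `C₁ ≤ 1/2` (2001 "trivial design"). [folklore] -/
theorem exists_C1 (c : ℕ → ℝ)
    (hTI : ∀ α : ℕ → ℂ, ∀ L : ℕ, (∀ m, L < m → α m = 0) →
      ∃ T : ℝ, Tendsto (fun x : ℝ => ∑ n ∈ Finset.Icc 1 ⌊x⌋₊,
          (c n - ArithmeticFunction.vonMangoldt n) / n *
            (∑ ℓ ∈ Finset.Icc 1 L, ∑ ℓ' ∈ Finset.Icc 1 L, α ℓ * (starRingEnd ℂ) (α ℓ') *
            (((Nat.gcd (n * ℓ') ℓ : ℕ) : ℝ) : ℂ) / (Real.sqrt ((ℓ : ℝ) * ℓ') : ℂ)).re) atTop (𝓝 T) ∧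
        T ≤ 1 / 2 * (∑ ℓ ∈ Finset.Icc 1 L, ∑ ℓ' ∈ Finset.Icc 1 L, α ℓ * (starRingEnd ℂ) (α ℓ') *
            (((Nat.gcd (1 * ℓ') ℓ : ℕ) : ℝ) : ℂ) / (Real.sqrt ((ℓ : ℝ) * ℓ') : ℂ)).re) :
    ∃ C₁ : ℝ, Tendsto (fun x : ℝ => ∑ n ∈ Finset.Icc 1 ⌊x⌋₊,
        (c n - ArithmeticFunction.vonMangoldt n) / n) atTop (𝓝 C₁) ∧ C₁ ≤ 1 / 2 := by
  obtain ⟨T, hT, hle⟩ := hTI (fun ℓ => if ℓ = 1 then 1 else 0) 1 (fun m hm => if_neg (by omega))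
  have hker : ∀ n : ℕ, (∑ ℓ ∈ Finset.Icc 1 1, ∑ ℓ' ∈ Finset.Icc 1 1,
      (fun ℓ => if ℓ = 1 then (1 : ℂ) else 0) ℓ * (starRingEnd ℂ) ((fun ℓ => if ℓ = 1 then (1 : ℂ) else 0) ℓ') *
        (((Nat.gcd (n * ℓ') ℓ : ℕ) : ℝ) : ℂ) / (Real.sqrt ((ℓ : ℝ) * ℓ') : ℂ)).re = 1 := by
    intro n
    simp
  refine ⟨T, ?_, ?_⟩
  · refine hT.congr fun x => Finset.sum_congr rfl fun n _ => ?_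
    rw [hker n, mul_one]
  · simpa [hker 1] using hle

/-! ### TI for a design with gcd form `K · Z` -/

/-- **TI along a normalised profile.**  If a finitely supported design has gcd form `K · Z(n)` (`K > 0`, `n ≥ 1`), the
type inequality gives a limit `T ≤ ½ Re Z(1)` of the partial sums of `(d(n)/n) Re Z(n)`. [folklore] -/
theorem tendsto_TI_profile (c : ℕ → ℝ)
    (hTI : ∀ α : ℕ → ℂ, ∀ L : ℕ, (∀ m, L < m → α m = 0) →
      ∃ T : ℝ, Tendsto (fun x : ℝ => ∑ n ∈ Finset.Icc 1 ⌊x⌋₊,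
          (c n - ArithmeticFunction.vonMangoldt n) / n *
            (∑ ℓ ∈ Finset.Icc 1 L, ∑ ℓ' ∈ Finset.Icc 1 L, α ℓ * (starRingEnd ℂ) (α ℓ') *
            (((Nat.gcd (n * ℓ') ℓ : ℕ) : ℝ) : ℂ) / (Real.sqrt ((ℓ : ℝ) * ℓ') : ℂ)).re) atTop (𝓝 T) ∧
        T ≤ 1 / 2 * (∑ ℓ ∈ Finset.Icc 1 L, ∑ ℓ' ∈ Finset.Icc 1 L, α ℓ * (starRingEnd ℂ) (α ℓ') *
            (((Nat.gcd (1 * ℓ') ℓ : ℕ) : ℝ) : ℂ) / (Real.sqrt ((ℓ : ℝ) * ℓ') : ℂ)).re)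
    (α : ℕ → ℂ) (L : ℕ) (K : ℝ) (hK : 0 < K) (hsupp : ∀ m, L < m → α m = 0) (Z : ℕ → ℂ)
    (hZ : ∀ n : ℕ, n ≠ 0 →
      (∑ ℓ ∈ Finset.Icc 1 L, ∑ ℓ' ∈ Finset.Icc 1 L, α ℓ * (starRingEnd ℂ) (α ℓ') *
        (((Nat.gcd (n * ℓ') ℓ : ℕ) : ℝ) : ℂ) / (Real.sqrt ((ℓ : ℝ) * ℓ') : ℂ)) = (K : ℂ) * Z n) :
    ∃ T : ℝ, Tendsto (fun x : ℝ => ∑ n ∈ Finset.Icc 1 ⌊x⌋₊,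
        (c n - ArithmeticFunction.vonMangoldt n) / n * (Z n).re) atTop (𝓝 T) ∧ T ≤ 1 / 2 * (Z 1).re := by
  obtain ⟨T₀, hT₀, hle⟩ := hTI α L hsupp
  refine ⟨T₀ / K, ?_, ?_⟩
  · have h1 : Tendsto (fun x : ℝ => K⁻¹ * ∑ n ∈ Finset.Icc 1 ⌊x⌋₊,
        (c n - ArithmeticFunction.vonMangoldt n) / n *
          (∑ ℓ ∈ Finset.Icc 1 L, ∑ ℓ' ∈ Finset.Icc 1 L, α ℓ * (starRingEnd ℂ) (α ℓ') *
          (((Nat.gcd (n * ℓ') ℓ : ℕ) : ℝ) : ℂ) / (Real.sqrt ((ℓ : ℝ) * ℓ') : ℂ)).re) atTop (𝓝 (K⁻¹ * T₀)) :=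
      hT₀.const_mul K⁻¹
    rw [div_eq_inv_mul]
    refine h1.congr fun x => ?_
    rw [Finset.mul_sum]
    refine Finset.sum_congr rfl fun n hn => ?_
    have hn0 : n ≠ 0 := by
      have := (Finset.mem_Icc.1 hn).1
      omega
    rw [hZ n hn0, Complex.re_ofReal_mul]
    field_simp
  · rw [hZ 1 one_ne_zero, Complex.re_ofReal_mul] at hle
    rw [div_le_iff₀ hK]
    nlinarith

/-! ### Loc: absolute summability on multiples of primes -/

/-- `Σ_{p ∣ n} Λ(n)/n < ∞` for a prime `p` (only the powers `p^k` contribute). [folklore] -/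
theorem summable_dvd_vonMangoldt_div (p : ℕ) (hp : p.Prime) :
    Summable (fun n : ℕ => if p ∣ n then ArithmeticFunction.vonMangoldt n / n else 0) := by
  have hB := summable_vonMangoldt_nonprime_rpow (σ := 1) (by norm_num)
  have hF : Summable (fun n : ℕ => if n = p then Real.log p / p else (0 : ℝ)) :=
    summable_of_ne_finset_zero (s := {p}) (by intro n hn; rw [if_neg]; simpa using hn)
  refine Summable.of_nonneg_of_le (fun n => ?_) (fun n => ?_) (hB.add hF)
  · split_ifs
    · exact div_nonneg ArithmeticFunction.vonMangoldt_nonneg (Nat.cast_nonneg _)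
    · exact le_rfl
  · have hrpow : (n : ℝ) ^ (-(1 : ℝ)) = 1 / n := by
      rw [Real.rpow_neg (Nat.cast_nonneg _), Real.rpow_one, one_div]
    by_cases hpn : p ∣ n
    · rw [if_pos hpn]
      by_cases hnp : n.Prime
      · -- then `n = p`
        have hnp' : n = p := ((Nat.prime_dvd_prime_iff_eq hp hnp).1 hpn).symm
        rw [if_pos hnp, if_pos hnp', hnp', ArithmeticFunction.vonMangoldt_apply_prime hp]
        simp
      · rw [if_neg hnp, if_neg (fun h => hnp (by rw [h]; exact hp)), hrpow, add_zero, mul_one_div]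
    · rw [if_neg hpn]
      have h1 : 0 ≤ (if n.Prime then 0 else ArithmeticFunction.vonMangoldt n) * (n : ℝ) ^ (-(1 : ℝ)) := by
        refine mul_nonneg ?_ (Real.rpow_nonneg (Nat.cast_nonneg _) _)
        split_ifs
        · exact le_rfl
        · exact ArithmeticFunction.vonMangoldt_nonneg
      have h2 : 0 ≤ (if n = p then Real.log p / p else (0 : ℝ)) := by
        split_ifs
        · exact div_nonneg (Real.log_nonneg (by exact_mod_cast hp.one_lt.le)) (Nat.cast_nonneg _)
        · exact le_rfl
      exact add_nonneg h1 h2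

/-- Loc ⟹ `Σ_{p ∣ n} |c(n) − Λ(n)|/n < ∞` for every prime `p`. [folklore] -/
theorem summable_dvd_abs_dwt_div (c : ℕ → ℝ) (hc0 : ∀ n, 0 ≤ c n)
    (hLoc : ∀ p : ℕ, p.Prime → Summable (fun n : ℕ => if p ∣ n then c n / n else 0)) (p : ℕ) (hp : p.Prime) :
    Summable (fun n : ℕ => if p ∣ n then |c n - ArithmeticFunction.vonMangoldt n| / n else 0) := by
  refine Summable.of_nonneg_of_le (fun n => ?_) (fun n => ?_) ((hLoc p hp).add (summable_dvd_vonMangoldt_div p hp))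
  · split_ifs
    · positivity
    · exact le_rfl
  · split_ifs with h
    · rw [← add_div]
      refine div_le_div_of_nonneg_right ?_ (Nat.cast_nonneg _)
      have h1 := hc0 n
      have h2 := ArithmeticFunction.vonMangoldt_nonneg (n := n)
      exact abs_sub_le_iff.2 ⟨by linarith, by linarith⟩
    · simp

/-- Loc ⟹ `d(n)/n` is absolutely summable on the integers touching a finite set `Q` of primes. [folklore] -/
theorem summable_touch_abs_dwt_div (c : ℕ → ℝ) (hc0 : ∀ n, 0 ≤ c n)
    (hLoc : ∀ p : ℕ, p.Prime → Summable (fun n : ℕ => if p ∣ n then c n / n else 0))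
    (Q : Finset ℕ) (hQ : ∀ q ∈ Q, q.Prime) :
    Summable (fun n : ℕ => if (∃ q ∈ Q, q ∣ n) then |c n - ArithmeticFunction.vonMangoldt n| / n else 0) := by
  classical
  have hS : Summable (fun n : ℕ => ∑ q ∈ Q,
      (if q ∣ n then |c n - ArithmeticFunction.vonMangoldt n| / n else 0)) :=
    summable_sum fun q hq => summable_dvd_abs_dwt_div c hc0 hLoc q (hQ q hq)
  refine Summable.of_nonneg_of_le (fun n => ?_) (fun n => ?_) hS
  · split_ifs
    · positivity
    · exact le_rfl
  · split_ifs with h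
    · obtain ⟨q, hq, hqn⟩ := h
      have := Finset.single_le_sum (s := Q)
        (f := fun q => (if q ∣ n then |c n - ArithmeticFunction.vonMangoldt n| / n else 0))
        (fun i _ => by positivity) hq
      simpa [if_pos hqn] using this
    · exact Finset.sum_nonneg fun i _ => by positivity

/-- **Decomposition of a TI limit along the `Q`-touching integers.**  If `ψ` is bounded and equals `ψ₀` at every
`n ≥ 1` coprime to the primes of `Q`, then the touching part `𝟙_{touch}(d/n)(ψ − ψ₀)` is summable (Loc) and the
limit `T` of the partial sums of `(d(n)/n) ψ(n)` is `ψ₀ C₁ + Σ'_{touch} (d(n)/n)(ψ(n) − ψ₀)`. [folklore] -/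
theorem TI_touch_decomposition (c : ℕ → ℝ) (hc0 : ∀ n, 0 ≤ c n)
    (hLoc : ∀ p : ℕ, p.Prime → Summable (fun n : ℕ => if p ∣ n then c n / n else 0))
    (Q : Finset ℕ) (hQ : ∀ q ∈ Q, q.Prime) (ψ : ℕ → ℝ) (ψ₀ B : ℝ)
    (hψ : ∀ n : ℕ, n ≠ 0 → (¬ ∃ q ∈ Q, q ∣ n) → ψ n = ψ₀) (hB : ∀ n, |ψ n| ≤ B)
    (C₁ : ℝ) (hC₁ : Tendsto (fun x : ℝ => ∑ n ∈ Finset.Icc 1 ⌊x⌋₊,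
        (c n - ArithmeticFunction.vonMangoldt n) / n) atTop (𝓝 C₁))
    (T : ℝ) (hT : Tendsto (fun x : ℝ => ∑ n ∈ Finset.Icc 1 ⌊x⌋₊,
        (c n - ArithmeticFunction.vonMangoldt n) / n * ψ n) atTop (𝓝 T)) :
    Summable (fun n : ℕ => if (∃ q ∈ Q, q ∣ n) then
        (c n - ArithmeticFunction.vonMangoldt n) / n * (ψ n - ψ₀) else 0) ∧
      T = ψ₀ * C₁ + ∑' n : ℕ, (if (∃ q ∈ Q, q ∣ n) then
        (c n - ArithmeticFunction.vonMangoldt n) / n * (ψ n - ψ₀) else 0) := by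
  classical
  set g : ℕ → ℝ := fun n => if (∃ q ∈ Q, q ∣ n) then
      (c n - ArithmeticFunction.vonMangoldt n) / n * (ψ n - ψ₀) else 0 with hg
  have hgs : Summable g := by
    have habs := summable_touch_abs_dwt_div c hc0 hLoc Q hQ
    refine Summable.of_norm_bounded (habs.mul_left (B + |ψ₀|)) fun n => ?_
    simp only [hg, Real.norm_eq_abs]
    split_ifs with h
    · rw [abs_mul, abs_div, Nat.abs_cast]
      have h1 : |ψ n - ψ₀| ≤ B + |ψ₀| := (abs_sub _ _).trans (by linarith [hB n])
      have h2 : 0 ≤ |c n - ArithmeticFunction.vonMangoldt n| / (n : ℝ) := by positivity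
      calc |c n - ArithmeticFunction.vonMangoldt n| / (n : ℝ) * |ψ n - ψ₀|
          ≤ |c n - ArithmeticFunction.vonMangoldt n| / (n : ℝ) * (B + |ψ₀|) := by gcongr
        _ = (B + |ψ₀|) * (|c n - ArithmeticFunction.vonMangoldt n| / (n : ℝ)) := by ring
    · simp
  have hg0 : g 0 = 0 := by simp [hg]
  refine ⟨hgs, ?_⟩
  have hlim : Tendsto (fun x : ℝ => ∑ n ∈ Finset.Icc 1 ⌊x⌋₊,
      (c n - ArithmeticFunction.vonMangoldt n) / n * ψ n) atTop (𝓝 (ψ₀ * C₁ + ∑' n, g n)) := by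
    have h := (hC₁.const_mul ψ₀).add (tendsto_sum_Icc_floor_of_summable g hg0 hgs)
    refine h.congr fun x => ?_
    rw [Finset.mul_sum, ← Finset.sum_add_distrib]
    refine Finset.sum_congr rfl fun n hn => ?_
    have hn0 : n ≠ 0 := by
      have := (Finset.mem_Icc.1 hn).1
      omega
    simp only [hg]
    split_ifs with h
    · ring
    · rw [hψ n hn0 h]
      ring
  exact tendsto_nhds_unique hT hlim

/-- **Registered sub-goal `designTouchDecomposition`** (seat-0 anchor of this file, design algebra §2 of the proof
of `stub_designOfTypes`): Loc makes the `Q`-touching part of a bounded profile absolutely summable, and a TI limit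
splits as `ψ₀ C₁ +` that touching `tsum`. [folklore] -/
theorem designTouchDecomposition : ∀ c : ℕ → ℝ, (∀ n, 0 ≤ c n) →
    (∀ p : ℕ, p.Prime → Summable (fun n : ℕ => if p ∣ n then c n / n else 0)) →
    ∀ Q : Finset ℕ, (∀ q ∈ Q, q.Prime) → ∀ ψ : ℕ → ℝ, ∀ ψ₀ B : ℝ,
    (∀ n : ℕ, n ≠ 0 → (¬ ∃ q ∈ Q, q ∣ n) → ψ n = ψ₀) → (∀ n, |ψ n| ≤ B) →
    ∀ C₁ : ℝ, Filter.Tendsto (fun x : ℝ => ∑ n ∈ Finset.Icc 1 ⌊x⌋₊,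
        (c n - ArithmeticFunction.vonMangoldt n) / n) Filter.atTop (nhds C₁) →
    ∀ T : ℝ, Filter.Tendsto (fun x : ℝ => ∑ n ∈ Finset.Icc 1 ⌊x⌋₊,
        (c n - ArithmeticFunction.vonMangoldt n) / n * ψ n) Filter.atTop (nhds T) →
    Summable (fun n : ℕ => if (∃ q ∈ Q, q ∣ n) then
        (c n - ArithmeticFunction.vonMangoldt n) / n * (ψ n - ψ₀) else 0) ∧
      T = ψ₀ * C₁ + ∑' n : ℕ, (if (∃ q ∈ Q, q ∣ n) then
        (c n - ArithmeticFunction.vonMangoldt n) / n * (ψ n - ψ₀) else 0) :=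
  fun c hc0 hLoc Q hQ ψ ψ₀ B hψ hB C₁ hC₁ T hT =>
    TI_touch_decomposition c hc0 hLoc Q hQ ψ ψ₀ B hψ hB C₁ hC₁ T hT

end Design

end Summit.RiemannHypothesis.RiemannHypothesis.Theorems.SignConeConeMagnification
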